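import Summits.PneNP.PneNP.Theorems.ConstantBand.Negative.LoadBearing
import Summits.PneNP.PneNP.Theorems.SingleThreshold.Negative.Locality
import Summits.PneNP.PneNP.Theorems.SliceACZero.Negative.DeltaBeforeK
import Literature.Computability.Complexity.CliqueThresholdBounds

/-!
# Line `Sketch-ideator3-r1` for crux `SliceTarget` (stmt-PneNP-2832) — stub T3 `FibreCliqueLower`,
# auxiliary counting lemmas

Generic finite counting behind the slice second moment on a fibre (stub `stub_fibreCliqueLower` of
`Summit.PneNP.PneNP.Cruxes.SliceTarget.Ideator3Line`, file `OneSliceSliceTargetFibreCliqueLower.lean`):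

* `fcl_sq_sum_card_le` — the second-moment count (Cauchy–Schwarz on the counting measure): for a family
  `Y` of sets and "patterns" `S i`, `(Σ_i #{y ∈ Y : S_i ⊆ y})² ≤ #{y ∈ Y : ∃ i, S_i ⊆ y} · Σ_{i,i'} #{y : S_i ∪ S_{i'} ⊆ y}`.
* `fcl_card_filter_supset_le` — among the `m`-subsets of `V`, at most `C(#V, m)·(m/#V)^{#T}` contain `T`;
  `fcl_choose_mul_pow_le_choose_sub` — conversely `C(M - K, m - K) ≥ C(M, m)·((m + 1 - K)/M)^K`.
* `fcl_card_union_cliqueEdges`, `fcl_sum_pow_card_union_le` — `|K_A ∪ K_B| = C(k,2) + (C(k,2) - C(|A ∩ B|,2))`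
  and the overlap sum at the threshold (through `sum_erase_pow_inter_le`).
* `fcl_choose_le_card_avoiding_add` — all but `#F · C(n-2,k-2)` of the `k`-sets have no edge in `F`.
* `fcl_card_fibre_filter` — the fibre `{x ∈ slice_j : x|_F = ρ|_F}` is in bijection with the
  `(j - |ρ⁻¹(1) ∩ F|)`-subsets of `Fᶜ` via `x ↦ supp x ∖ F`, transporting any predicate of `supp x ∖ F`.

All statements are finite and exact; no asymptotics here. Worker file for the line lead
prover-line-stmt-PneNP-2832-0, 2026-08-16.
-/

set_option linter.dupNamespace false

namespace Summit.PneNP.PneNP.Cruxes.SliceTarget.Ideator3Line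

open Literature.Computability.Complexity Finset Filter Classical
open scoped Topology
open Summit.PneNP.PneNP.Theorems.ConstantBand.Negative (Edge thr Central slice)
open Summit.PneNP.PneNP.Theorems.SingleThreshold.Negative (Edges zeroOn pc pc_nonneg pc_le_one tendsto_pc)
open Summit.PneNP.PneNP.Theorems.SliceACZero.Negative (sliceCard sliceCard_eq card_slice_supset_le
  choose_sub_mul_pow_le_choose_mul_pow card_supp supp_injective supp_indicator mem_supp)
open Summit.PneNP.PneNP.Theorems.SliceACZero.Negative renaming supp → esupp

noncomputable section

/-! ## The second-moment count -/

/-- **Second-moment count** (Cauchy–Schwarz / Paley–Zygmund on the counting measure). For a finite family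
`Y` of finite sets and patterns `S i` (`i ∈ I`), writing `ω(y) = #{i ∈ I : S_i ⊆ y}`:
`(Σ_{y ∈ Y} ω(y))² ≤ #{y ∈ Y : ω(y) ≥ 1} · Σ_{y ∈ Y} ω(y)²`, with both sides expanded by double counting:
`Σ_y ω(y) = Σ_i #{y : S_i ⊆ y}` and `Σ_y ω(y)² = Σ_{i,i'} #{y : S_i ∪ S_{i'} ⊆ y}`. [folklore] -/
theorem fcl_sq_sum_card_le {α ι : Type*} [DecidableEq α] (Y : Finset (Finset α)) (I : Finset ι)
    (S : ι → Finset α) :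
    (∑ i ∈ I, (#(Y.filter fun y => S i ⊆ y) : ℝ)) ^ 2 ≤
      #(Y.filter fun y => ∃ i ∈ I, S i ⊆ y) *
        ∑ i ∈ I, ∑ i' ∈ I, (#(Y.filter fun y => S i ∪ S i' ⊆ y) : ℝ) := by
  set w : Finset α → ℝ := fun y => ∑ i ∈ I, if S i ⊆ y then (1 : ℝ) else 0 with hw
  set g : Finset α → ℝ := fun y => if ∃ i ∈ I, S i ⊆ y then (1 : ℝ) else 0 with hg
  have hwg : ∀ y, w y * g y = w y := by
    intro y
    by_cases h : ∃ i ∈ I, S i ⊆ y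
    · simp [hg, h]
    · have h0 : w y = 0 := by
        refine sum_eq_zero fun i hi => ?_
        rw [if_neg]
        exact fun hs => h ⟨i, hi, hs⟩
      rw [h0, zero_mul]
  have h1 : ∑ i ∈ I, (#(Y.filter fun y => S i ⊆ y) : ℝ) = ∑ y ∈ Y, w y * g y := by
    simp_rw [hwg, hw]
    rw [sum_comm]
    exact sum_congr rfl fun i _ => (sum_boole _ _).symm
  have h2 : ∑ y ∈ Y, g y ^ 2 = #(Y.filter fun y => ∃ i ∈ I, S i ⊆ y) := by
    have hgg : ∀ y, g y ^ 2 = g y := by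
      intro y
      simp only [hg]
      split_ifs <;> norm_num
    simp_rw [hgg, hg]
    exact sum_boole _ _
  have h3 : ∑ y ∈ Y, w y ^ 2 = ∑ i ∈ I, ∑ i' ∈ I, (#(Y.filter fun y => S i ∪ S i' ⊆ y) : ℝ) := by
    calc ∑ y ∈ Y, w y ^ 2
        = ∑ y ∈ Y, ∑ i ∈ I, ∑ i' ∈ I,
            (if S i ⊆ y then (1 : ℝ) else 0) * (if S i' ⊆ y then (1 : ℝ) else 0) :=
          sum_congr rfl fun y _ => by rw [sq, hw, sum_mul_sum]
      _ = ∑ i ∈ I, ∑ y ∈ Y, ∑ i' ∈ I,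
            (if S i ⊆ y then (1 : ℝ) else 0) * (if S i' ⊆ y then (1 : ℝ) else 0) := sum_comm
      _ = ∑ i ∈ I, ∑ i' ∈ I, ∑ y ∈ Y, (if S i ∪ S i' ⊆ y then (1 : ℝ) else 0) := by
          refine sum_congr rfl fun i _ => ?_
          rw [sum_comm]
          refine sum_congr rfl fun i' _ => sum_congr rfl fun y _ => ?_
          rw [ite_zero_mul_ite_zero, one_mul]
          exact if_congr union_subset_iff.symm rfl rfl
      _ = _ := sum_congr rfl fun i _ => sum_congr rfl fun i' _ => sum_boole _ _
  calc (∑ i ∈ I, (#(Y.filter fun y => S i ⊆ y) : ℝ)) ^ 2 = (∑ y ∈ Y, w y * g y) ^ 2 := by rw [h1]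
    _ ≤ (∑ y ∈ Y, w y ^ 2) * ∑ y ∈ Y, g y ^ 2 := sum_mul_sq_le_sq_mul_sq Y w g
    _ = _ := by rw [h2, h3, mul_comm]

/-! ## Subsets of a given size containing a fixed set: ratio bounds -/

/-- Among the `m`-subsets of `V` (`V ≠ ∅`), at most `C(#V, m) · (m/#V)^{#T}` contain a fixed `T ⊆ V`
(exact count `C(#V - #T, m - #T)` and `C(N-a, m-a)·N^a ≤ C(N,m)·m^a`; the family is empty when `#T > m`
or `m > #V`). [folklore] -/
theorem fcl_card_filter_supset_le {α : Type*} [DecidableEq α] (V T : Finset α) (m : ℕ) (hT : T ⊆ V)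
    (hV : 0 < #V) :
    (#((V.powersetCard m).filter fun y => T ⊆ y) : ℝ) ≤ ((#V).choose m : ℝ) * ((m : ℝ) / #V) ^ #T := by
  have hV' : (0 : ℝ) < #V := by exact_mod_cast hV
  have hR : 0 ≤ ((#V).choose m : ℝ) * ((m : ℝ) / #V) ^ #T := by positivity
  by_cases hTm : #T ≤ m
  · by_cases hmV : m ≤ #V
    · rw [card_filter_powersetCard_subset T V m hT hTm, div_pow, ← mul_div_assoc,
        le_div_iff₀ (by positivity)]
      exact_mod_cast choose_sub_mul_pow_le_choose_mul_pow hTm hmV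
    · rw [powersetCard_eq_empty.2 (not_le.1 hmV), filter_empty, card_empty, Nat.cast_zero]
      exact hR
  · have h0 : (V.powersetCard m).filter (fun y => T ⊆ y) = ∅ := by
      refine filter_eq_empty_iff.2 fun y hy hTy => hTm ?_
      rw [← (mem_powersetCard.1 hy).2]
      exact card_le_card hTy
    rw [h0, card_empty, Nat.cast_zero]
    exact hR

/-- Conversely `C(M - K, m - K) ≥ C(M, m) · ((m + 1 - K)/M)^K` for `K ≤ m`, `0 < M` (trivial if `m > M`): by
`C(M,m)·C(m,K) = C(M,K)·C(M-K,m-K)` (`Nat.choose_mul`), `C(m,K) ≥ (m+1-K)^K/K!` and `C(M,K) ≤ M^K/K!`.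
[folklore] -/
theorem fcl_choose_mul_pow_le_choose_sub {M m K : ℕ} (hKm : K ≤ m) (hM : 0 < M) :
    (M.choose m : ℝ) * (((m : ℝ) + 1 - K) / M) ^ K ≤ ((M - K).choose (m - K) : ℝ) := by
  have hM' : (0 : ℝ) < M := by exact_mod_cast hM
  have h1 : (M.choose m : ℝ) * (m.choose K : ℝ) = (M.choose K : ℝ) * ((M - K).choose (m - K) : ℝ) := by
    exact_mod_cast Nat.choose_mul hKm
  have h2 : ((m : ℝ) + 1 - K) ^ K / (K.factorial : ℝ) ≤ (m.choose K : ℝ) := by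
    have := Nat.pow_le_choose K m (α := ℝ)
    rwa [Nat.cast_sub (by omega), Nat.cast_add, Nat.cast_one] at this
  have h3 : (M.choose K : ℝ) ≤ (M : ℝ) ^ K / (K.factorial : ℝ) := Nat.choose_le_pow_div K M
  have hfact : (0 : ℝ) < K.factorial := by exact_mod_cast Nat.factorial_pos K
  have key : (M.choose m : ℝ) * (((m : ℝ) + 1 - K) ^ K / K.factorial) ≤
      (M : ℝ) ^ K / K.factorial * ((M - K).choose (m - K) : ℝ) := by
    calc (M.choose m : ℝ) * (((m : ℝ) + 1 - K) ^ K / K.factorial)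
        ≤ (M.choose m : ℝ) * (m.choose K : ℝ) := mul_le_mul_of_nonneg_left h2 (Nat.cast_nonneg _)
      _ = (M.choose K : ℝ) * ((M - K).choose (m - K) : ℝ) := h1
      _ ≤ _ := mul_le_mul_of_nonneg_right h3 (Nat.cast_nonneg _)
  have hMK : (0 : ℝ) < (M : ℝ) ^ K := by positivity
  rw [div_pow, ← mul_div_assoc, div_le_iff₀ hMK]
  have key' := mul_le_mul_of_nonneg_right key hfact.le
  calc (M.choose m : ℝ) * ((m : ℝ) + 1 - K) ^ K
      = (M.choose m : ℝ) * (((m : ℝ) + 1 - K) ^ K / K.factorial) * K.factorial := by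
        field_simp
    _ ≤ (M : ℝ) ^ K / K.factorial * ((M - K).choose (m - K) : ℝ) * K.factorial := key'
    _ = ((M - K).choose (m - K) : ℝ) * (M : ℝ) ^ K := by
        field_simp

/-! ## Clique edge sets: unions and the overlap sum -/

/-- `|K_A ∪ K_B| = C(k,2) + (C(k,2) - C(|A ∩ B|,2))` for `k`-sets `A, B` (the edges of `K_A` outside `K_B`
number `C(k,2) - C(|A ∩ B|,2)`, `card_filter_cliqueVec_and_not`). [folklore] -/
theorem fcl_card_union_cliqueEdges {n k : ℕ} {A B : Finset (Fin n)} (hA : #A = k) (hB : #B = k) :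
    #((univ.filter fun e : Edge n => cliqueVec A e = true) ∪
        (univ.filter fun e : Edge n => cliqueVec B e = true)) =
      k.choose 2 + (k.choose 2 - (#(A ∩ B)).choose 2) := by
  have hsd : (univ.filter fun e : Edge n => cliqueVec A e = true) \
      (univ.filter fun e : Edge n => cliqueVec B e = true) =
      univ.filter fun e : Edge n => cliqueVec A e = true ∧ cliqueVec B e = false := by
    ext e
    simp
  rw [← card_sdiff_add_card, hsd, card_filter_cliqueVec_and_not B A, card_filter_cliqueVec, hA, hB,
    inter_comm, add_comm]

/-- **The overlap sum at the threshold** for the union exponent: for a `k`-set `A` (`k ≥ 2`, `n ≥ 1`),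
`0 ≤ q ≤ b · n^{-2/(k-1)}`, `b ≥ 1`, and any family `𝒜'` of `k`-sets,
`Σ_{B ∈ 𝒜'} q^{|K_A ∪ K_B|} ≤ q^{C(k,2)} · (1 + k · 2^k · b^{C(k,2)})` (the term `B = A` and
`sum_erase_pow_inter_le`). [folklore] -/
theorem fcl_sum_pow_card_union_le {n k : ℕ} (hk : 2 ≤ k) (hn : 1 ≤ n) {q b : ℝ} (hq0 : 0 ≤ q)
    (hb : 1 ≤ b) (hqb : q ≤ b * (n : ℝ) ^ (-(2 : ℝ) / ((k : ℝ) - 1))) {A : Finset (Fin n)}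
    (hA : A ∈ powersetCard k (univ : Finset (Fin n))) (𝒜' : Finset (Finset (Fin n)))
    (h𝒜' : 𝒜' ⊆ powersetCard k univ) :
    ∑ B ∈ 𝒜', q ^ #((univ.filter fun e : Edge n => cliqueVec A e = true) ∪
        (univ.filter fun e : Edge n => cliqueVec B e = true)) ≤
      q ^ k.choose 2 * (1 + k * 2 ^ k * b ^ k.choose 2) := by
  have hAk : #A = k := (mem_powersetCard.1 hA).2
  set f : Finset (Fin n) → ℝ := fun B => q ^ #((univ.filter fun e : Edge n => cliqueVec A e = true) ∪
    (univ.filter fun e : Edge n => cliqueVec B e = true)) with hf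
  have hfA : f A = q ^ k.choose 2 := by
    simp only [hf]
    rw [union_self, card_filter_cliqueVec, hAk]
  have hfB : ∀ B ∈ (powersetCard k (univ : Finset (Fin n))).erase A,
      f B = q ^ k.choose 2 * q ^ (k.choose 2 - (#(A ∩ B)).choose 2) := by
    intro B hB
    have hBk : #B = k := (mem_powersetCard.1 (mem_erase.1 hB).2).2
    simp only [hf]
    rw [fcl_card_union_cliqueEdges hAk hBk, pow_add]
  calc ∑ B ∈ 𝒜', f B ≤ ∑ B ∈ powersetCard k univ, f B :=
        sum_le_sum_of_subset_of_nonneg h𝒜' fun _ _ _ => pow_nonneg hq0 _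
    _ = f A + ∑ B ∈ (powersetCard k univ).erase A, f B := (add_sum_erase _ _ hA).symm
    _ = q ^ k.choose 2 + ∑ B ∈ (powersetCard k univ).erase A,
          q ^ k.choose 2 * q ^ (k.choose 2 - (#(A ∩ B)).choose 2) := by
        rw [hfA, sum_congr rfl hfB]
    _ = q ^ k.choose 2 * (1 + ∑ B ∈ (powersetCard k univ).erase A,
          q ^ (k.choose 2 - (#(A ∩ B)).choose 2)) := by
        rw [← mul_sum]
        ring
    _ ≤ q ^ k.choose 2 * (1 + k * 2 ^ k * b ^ k.choose 2) :=
        mul_le_mul_of_nonneg_left (add_le_add le_rfl (sum_erase_pow_inter_le hk hn hq0 hb hqb hA))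
          (pow_nonneg hq0 _)

/-- **Most `k`-sets avoid `F`.** The `k`-sets `A` with an edge of `K_A` in `F` number at most
`#F · C(n-2, k-2)` (both endpoints of that edge lie in `A`: `card_filter_supset_le`), so
`C(n,k) ≤ #{A : K_A ⊆ Fᶜ} + #F · C(n-2,k-2)`. [folklore] -/
theorem fcl_choose_le_card_avoiding_add {n k : ℕ} (F : Finset (Edge n)) :
    n.choose k ≤ #((powersetCard k (univ : Finset (Fin n))).filter fun A =>
        (univ.filter fun e : Edge n => cliqueVec A e = true) ⊆ univ \ F) + #F * (n - 2).choose (k - 2) := by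
  set 𝒜 := powersetCard k (univ : Finset (Fin n)) with h𝒜
  have hcard : #𝒜 = n.choose k := by rw [h𝒜, card_powersetCard, card_univ, Fintype.card_fin]
  have hsplit := card_filter_add_card_filter_not (s := 𝒜)
    (fun A => (univ.filter fun e : Edge n => cliqueVec A e = true) ⊆ univ \ F)
  have hbad : #(𝒜.filter fun A => ¬ (univ.filter fun e : Edge n => cliqueVec A e = true) ⊆ univ \ F) ≤
      #F * (n - 2).choose (k - 2) := by
    calc _ ≤ #(F.biUnion fun e => 𝒜.filter fun A => endpts e ⊆ A) := by
          refine card_le_card fun A hA => ?_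
          rw [mem_filter] at hA
          obtain ⟨hA𝒜, hnot⟩ := hA
          rw [not_subset] at hnot
          obtain ⟨e, he, heF⟩ := hnot
          rw [mem_filter] at he
          have heF' : e ∈ F := by simpa using heF
          exact mem_biUnion.2 ⟨e, heF', mem_filter.2 ⟨hA𝒜, (cliqueVec_eq_true_iff_endpts A e).1 he.2⟩⟩
      _ ≤ ∑ e ∈ F, #(𝒜.filter fun A => endpts e ⊆ A) := card_biUnion_le
      _ ≤ ∑ _e ∈ F, (n - 2).choose (k - 2) := sum_le_sum fun e _ => by
          have h := card_filter_supset_le (k := k) (endpts e)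
          rwa [card_endpts] at h
      _ = #F * (n - 2).choose (k - 2) := by rw [sum_const, smul_eq_mul]
  omega

/-! ## The fibre of a slice over a pattern on `F` is a uniform layer of `Fᶜ` -/

/-- For `y ⊆ Fᶜ` and `R ⊆ F`: `(y ∪ R) ∖ F = y`. [folklore] -/
theorem fcl_union_sdiff_eq {α : Type*} [DecidableEq α] {y R F : Finset α} (hy : Disjoint y F) (hR : R ⊆ F) :
    (y ∪ R) \ F = y := by
  rw [union_sdiff_distrib, sdiff_eq_self_of_disjoint hy, sdiff_eq_empty_iff_subset.2 hR, union_empty]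

/-- **Fibre transport.** Let `R = {e ∈ F : ρ e = 1}`, `r = #R ≤ j`. The map `x ↦ supp x ∖ F` is a bijection
from the fibre `{x ∈ slice_j : x|_F = ρ|_F}` onto the `(j - r)`-subsets of `Fᶜ` (inverse: `y ↦ 1_{y ∪ R}`), so
for every predicate `P`, `#{x ∈ fibre : P (supp x ∖ F)} = #{y ⊆ Fᶜ : #y = j - r, P y}`. [folklore] -/
theorem fcl_card_fibre_filter {n j : ℕ} (F : Finset (Edge n)) (ρ : Edge n → Bool)
    (P : Finset (Edge n) → Prop) [DecidablePred P] (hr : #(F.filter fun e => ρ e = true) ≤ j) :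
    #(((slice n j).filter fun x => ∀ e ∈ F, x e = ρ e).filter fun x => P (esupp x \ F)) =
      #(((univ \ F).powersetCard (j - #(F.filter fun e => ρ e = true))).filter P) := by
  set R := F.filter fun e => ρ e = true with hR
  have hRF : R ⊆ F := filter_subset _ _
  -- the support of a fibre element meets `F` in `R`
  have hinter : ∀ x : Edge n → Bool, (∀ e ∈ F, x e = ρ e) → esupp x ∩ F = R := by
    intro x hxF
    ext e
    simp only [mem_inter, Theorems.SliceACZero.Negative.mem_supp, hR, mem_filter]
    constructor
    · rintro ⟨hxe, heF⟩
      exact ⟨heF, (hxF e heF) ▸ hxe⟩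
    · rintro ⟨heF, hρ⟩
      exact ⟨(hxF e heF).trans hρ, heF⟩
  refine card_nbij' (fun x => esupp x \ F) (fun y e => decide (e ∈ y ∪ R)) ?_ ?_ ?_ ?_
  · -- into the layer
    intro x hx
    rw [mem_coe, mem_filter, mem_filter] at hx
    obtain ⟨⟨hxs, hxF⟩, hP⟩ := hx
    dsimp only
    rw [mem_coe, mem_filter, mem_powersetCard]
    refine ⟨⟨sdiff_subset_sdiff (subset_univ _) Subset.rfl, ?_⟩, hP⟩
    have h := card_sdiff_add_card_inter (esupp x) F
    rw [hinter x hxF, card_supp, (mem_filter.1 hxs).2] at h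
    omega
  · -- back into the fibre
    intro y hy
    rw [mem_coe, mem_filter, mem_powersetCard] at hy
    obtain ⟨⟨hyF, hycard⟩, hP⟩ := hy
    have hdisjF : Disjoint y F := by
      rw [Finset.disjoint_left]
      intro e hey heF
      exact (Finset.mem_sdiff.1 (hyF hey)).2 heF
    have hdisj : Disjoint y R := disjoint_of_subset_right hRF hdisjF
    have hsupp : esupp (fun e => decide (e ∈ y ∪ R)) = y ∪ R := supp_indicator _
    have hcount : edgeCount (fun e => decide (e ∈ y ∪ R)) = j := by
      rw [← card_supp, hsupp, card_union_of_disjoint hdisj, hycard]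
      omega
    dsimp only
    rw [mem_coe, mem_filter, mem_filter]
    refine ⟨⟨mem_filter.2 ⟨mem_univ _, hcount⟩, fun e heF => ?_⟩, ?_⟩
    · have hey : e ∉ y := fun h => (Finset.mem_sdiff.1 (hyF h)).2 heF
      rw [Bool.eq_iff_iff, decide_eq_true_eq, mem_union, hR, mem_filter]
      tauto
    · rwa [hsupp, fcl_union_sdiff_eq hdisjF hRF]
  · -- left inverse
    intro x hx
    rw [mem_coe, mem_filter, mem_filter] at hx
    obtain ⟨⟨-, hxF⟩, -⟩ := hx
    funext e
    rw [Bool.eq_iff_iff, decide_eq_true_eq, mem_union, Finset.mem_sdiff, Theorems.SliceACZero.Negative.mem_supp,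
      hR, mem_filter]
    by_cases heF : e ∈ F
    · have := hxF e heF
      rw [this]
      tauto
    · tauto
  · -- right inverse
    intro y hy
    rw [mem_coe, mem_filter, mem_powersetCard] at hy
    obtain ⟨⟨hyF, -⟩, -⟩ := hy
    have hdisjF : Disjoint y F := by
      rw [Finset.disjoint_left]
      intro e hey heF
      exact (Finset.mem_sdiff.1 (hyF hey)).2 heF
    show esupp (fun e => decide (e ∈ y ∪ R)) \ F = y
    rw [supp_indicator, fcl_union_sdiff_eq hdisjF hRF]

/-- **Fibre transport, registered form** (sub-goal of stub T3 `stub_fibreCliqueLower`, closed statement): for every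
predicate `P` of the off-`F` support, `#{x ∈ slice_j : x|_F = ρ|_F, P (supp x ∖ F)} = #{y ⊆ Fᶜ : #y = j - r, P y}` with
`r = #{e ∈ F : ρ e = 1} ≤ j` (`fcl_card_fibre_filter`). [folklore] -/
theorem fcl_fibre_transport :
    ∀ (n j : ℕ) (F : Finset (Edge n)) (ρ : Edge n → Bool) (P : Finset (Edge n) → Prop),
      #(F.filter fun e => ρ e = true) ≤ j →
        #(((slice n j).filter fun x => ∀ e ∈ F, x e = ρ e).filter fun x =>
            P ((univ.filter fun e : Edge n => x e = true) \ F)) =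
          #(((univ \ F).powersetCard (j - #(F.filter fun e => ρ e = true))).filter P) :=
  fun _ _ F ρ P hr => fcl_card_fibre_filter F ρ P hr

end

end Summit.PneNP.PneNP.Cruxes.SliceTarget.Ideator3Line
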